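import Mathlib
import Summits.NavierStokesRegularity.NavierStokesRegularity.Theorems.SubcriticalEnvelopeDefs
import Summits.NavierStokesRegularity.NavierStokesRegularity.Theorems.SubOnsagerCeilingOrthantTailCeilingDyadicRatioTwoTools
import Summits.NavierStokesRegularity.NavierStokesRegularity.Theorems.SubcriticalEnvelopeForwardSourceTailEnvelopeRedressing
import Literature.Analysis.FluidPDE.TaoCascadeODEProofs
import HarnessLib

/-!
# `SubcriticalEnvelope.ForwardSourceTailEnvelopeKP` (stmt-NavierStokesRegularity-27130) — the KP
2-CYCLE as two INTERLEAVED CHAINS: closed forms, nonlinearity, the strand reduction and the honesty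
transfer (first of two files of the LEAD-SE rung «uniform KP 2-cycles», `--supports`)

LEAD-SE structural move named under KEY-NS #140 (2)(ii) / #142 (1).  The KP 2-cycle
`kpTwoCycleTable c₀ c₁` (feeds `x_{0,k}² → x_{1,k+1}` with `c₀`, `x_{1,k}² → x_{0,k+1}` with `c₁`;
`Theorems/SubcriticalEnvelopeDefs.lean`) is the simplest multi-mode KP-proper orthant architecture in
the class of the cruxes 27057 / 27130 / 26999.  Its lattice is TWO INTERLEAVED nearest-neighbour
chains («strands»): the strand `r` lives on component `cyclePhase r k = (k + r) mod 2` at shell `k`,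
and the drain partner of a mode is the next mode of the SAME strand.

* `kpTwoCycleTable_feed/_up1/_up2/_inshell`, `quadTerm_kpTwoCycle_zero/_one/_idle` — closed forms
  and the nonlinearity per component (components `2, 3` idle);
* `quadTerm_kpTwoCycle_phase` — GENERAL REDUCTION (any `c₀, c₁`): each strand obeys a chain
  equation with 2-PERIODIC coefficients (`(c₁, c₀)` on even, `(c₀, c₁)` on odd positions);
* `quadTerm_cycleStrand` — uniform coefficient: the strand's `c·dyadicTable` nonlinearity IS the
  2-cycle nonlinearity of the occupied mode (INTERTWINING, for every family `X`);
* `cycleStrand_honest` — strands of honest uniform-2-cycle solutions (one-shell datum, noLow, (4.5)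
  bound, continuity, exact ν-viscous motion, non-negative on shells `≥ 1`) are honest
  `c·dyadicTable` solutions from the data `X₀(cyclePhase r 0)·e₀`.

The rung itself (shell barrier / ceiling / 27130 clause at `ε₀ ∈ [7/10,1]`) is the sibling file
`…KPTwoCycle.lean`.

HONEST FRAMING: algebra and bookkeeping about Tao-type MODEL lattice ODEs (rung TL-M2Break); no crux
is proved; nothing here concerns the Navier–Stokes equations; NS regularity is NOT advanced.
-/

noncomputable section

-- the sub-problem namespace `NavierStokesRegularity.NavierStokesRegularity` is the tree's layout (D-0017)
set_option linter.dupNamespace false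

namespace Summit.NavierStokesRegularity.NavierStokesRegularity.Theorems

open Set
open Literature.Analysis.FluidPDE.TaoCascade

/-! ## §1 Closed forms of the 2-cycle table on the four shifts -/

/-- Values on the feed shift `(0,0,1)`. [this file] -/
theorem kpTwoCycleTable_feed (c₀ c₁ : ℝ) (i₁ i₂ i₃ : Fin 4) :
    kpTwoCycleTable c₀ c₁ i₁ i₂ i₃ ((0 : ℤ), (0 : ℤ), (1 : ℤ)) =
      (if i₁ = 0 ∧ i₂ = 0 ∧ i₃ = 1 then c₀ else 0) + (if i₁ = 1 ∧ i₂ = 1 ∧ i₃ = 0 then c₁ else 0) := by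
  simp [kpTwoCycleTable]

/-- Values on the shift `(1,0,0)`. [this file] -/
theorem kpTwoCycleTable_up1 (c₀ c₁ : ℝ) (i₁ i₂ i₃ : Fin 4) :
    kpTwoCycleTable c₀ c₁ i₁ i₂ i₃ ((1 : ℤ), (0 : ℤ), (0 : ℤ)) =
      (if i₁ = 1 ∧ i₂ = 0 ∧ i₃ = 0 then -(c₀ / 2) else 0) +
        (if i₁ = 0 ∧ i₂ = 1 ∧ i₃ = 1 then -(c₁ / 2) else 0) := by
  simp [kpTwoCycleTable]

/-- Values on the shift `(0,1,0)`. [this file] -/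
theorem kpTwoCycleTable_up2 (c₀ c₁ : ℝ) (i₁ i₂ i₃ : Fin 4) :
    kpTwoCycleTable c₀ c₁ i₁ i₂ i₃ ((0 : ℤ), (1 : ℤ), (0 : ℤ)) =
      (if i₁ = 0 ∧ i₂ = 1 ∧ i₃ = 0 then -(c₀ / 2) else 0) +
        (if i₁ = 1 ∧ i₂ = 0 ∧ i₃ = 1 then -(c₁ / 2) else 0) := by
  simp [kpTwoCycleTable]

/-- Values on the in-shell shift `(0,0,0)`: none. [this file] -/
theorem kpTwoCycleTable_inshell (c₀ c₁ : ℝ) (i₁ i₂ i₃ : Fin 4) :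
    kpTwoCycleTable c₀ c₁ i₁ i₂ i₃ ((0 : ℤ), (0 : ℤ), (0 : ℤ)) = 0 := by
  simp [kpTwoCycleTable]

/-! ## §2 The 2-cycle nonlinearity per component -/

/-- Component `0`: fed by `x_{1,n-1}²` (coefficient `c₁`), drained by its own feed into `(1, n+1)`
(coefficient `c₀`). [this file] -/
theorem quadTerm_kpTwoCycle_zero (ε₀ c₀ c₁ : ℝ) (X : Fin 4 → ℤ → ℝ → ℝ) (n : ℤ) (t : ℝ) :
    quadTerm ε₀ (kpTwoCycleTable c₀ c₁) X 0 n t =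
      c₁ * ((1 + ε₀) ^ ((5 : ℝ) * (n - 1) / 2) * X 1 (n - 1) t ^ 2) -
        c₀ * ((1 + ε₀) ^ ((5 : ℝ) * n / 2) * (X 0 n t * X 1 (n + 1) t)) := by
  simp [quadTerm, sum_shiftSet, Fin.sum_univ_four, kpTwoCycleTable_feed, kpTwoCycleTable_up1,
    kpTwoCycleTable_up2, kpTwoCycleTable_inshell]
  ring

/-- Component `1`: fed by `x_{0,n-1}²` (coefficient `c₀`), drained by its own feed into `(0, n+1)`
(coefficient `c₁`). [this file] -/
theorem quadTerm_kpTwoCycle_one (ε₀ c₀ c₁ : ℝ) (X : Fin 4 → ℤ → ℝ → ℝ) (n : ℤ) (t : ℝ) :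
    quadTerm ε₀ (kpTwoCycleTable c₀ c₁) X 1 n t =
      c₀ * ((1 + ε₀) ^ ((5 : ℝ) * (n - 1) / 2) * X 0 (n - 1) t ^ 2) -
        c₁ * ((1 + ε₀) ^ ((5 : ℝ) * n / 2) * (X 1 n t * X 0 (n + 1) t)) := by
  simp [quadTerm, sum_shiftSet, Fin.sum_univ_four, kpTwoCycleTable_feed, kpTwoCycleTable_up1,
    kpTwoCycleTable_up2, kpTwoCycleTable_inshell]
  ring

/-- Components `2`, `3` are idle: no structure constant targets them. [this file] -/
theorem kpTwoCycleTable_target_idle (c₀ c₁ : ℝ) {i : Fin 4} (hi2 : i = 2 ∨ i = 3) (i₁ i₂ : Fin 4) :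
    ∀ μ ∈ shiftSet, kpTwoCycleTable c₀ c₁ i₁ i₂ i μ = 0 := by
  intro μ hμ
  rw [mem_shiftSet_iff] at hμ
  rcases hμ with rfl | rfl | rfl | rfl <;> rcases hi2 with rfl | rfl <;>
    simp [kpTwoCycleTable_inshell, kpTwoCycleTable_feed, kpTwoCycleTable_up1, kpTwoCycleTable_up2]

/-- Hence the nonlinearity vanishes on components `2`, `3`. [this file] -/
theorem quadTerm_kpTwoCycle_idle (ε₀ c₀ c₁ : ℝ) (X : Fin 4 → ℤ → ℝ → ℝ) {i : Fin 4}
    (hi2 : i = 2 ∨ i = 3) (n : ℤ) (t : ℝ) : quadTerm ε₀ (kpTwoCycleTable c₀ c₁) X i n t = 0 :=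
  quadTerm_eq_zero_of_coeff_target (fun i₁ i₂ μ hμ => kpTwoCycleTable_target_idle c₀ c₁ hi2 i₁ i₂ μ hμ)
    X n t

/-! ## §3 Phase bookkeeping -/

/-- The phase is `0` or `1`. [this file] -/
theorem cyclePhase_eq_zero_or_one (r k : ℤ) : cyclePhase r k = 0 ∨ cyclePhase r k = 1 := by
  unfold cyclePhase; split_ifs <;> simp

/-- On an even position of the strand the neighbours are odd. [this file] -/
theorem cyclePhase_neighbours_of_even {r k : ℤ} (h : (k + r) % 2 = 0) :
    cyclePhase r k = 0 ∧ cyclePhase r (k - 1) = 1 ∧ cyclePhase r (k + 1) = 1 := by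
  refine ⟨by simp [cyclePhase, h], ?_, ?_⟩
  · have h1 : (k - 1 + r) % 2 ≠ 0 := by omega
    simp [cyclePhase, h1]
  · have h1 : (k + 1 + r) % 2 ≠ 0 := by omega
    simp [cyclePhase, h1]

/-- On an odd position of the strand the neighbours are even. [this file] -/
theorem cyclePhase_neighbours_of_odd {r k : ℤ} (h : (k + r) % 2 ≠ 0) :
    cyclePhase r k = 1 ∧ cyclePhase r (k - 1) = 0 ∧ cyclePhase r (k + 1) = 0 := by
  refine ⟨by simp [cyclePhase, h], ?_, ?_⟩
  · have h1 : (k - 1 + r) % 2 = 0 := by omega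
    simp [cyclePhase, h1]
  · have h1 : (k + 1 + r) % 2 = 0 := by omega
    simp [cyclePhase, h1]

/-- Component `0` of a strand reads the lattice at the phase; other components vanish. [this file] -/
theorem cycleStrand_zero (r : ℤ) (X : Fin 4 → ℤ → ℝ → ℝ) (k : ℤ) (t : ℝ) :
    cycleStrand r X 0 k t = X (cyclePhase r k) k t := by
  simp [cycleStrand]

/-- Components `≠ 0` of a strand vanish. [this file] -/
theorem cycleStrand_of_ne (r : ℤ) (X : Fin 4 → ℤ → ℝ → ℝ) {i : Fin 4} (hi : i ≠ 0) (k : ℤ) (t : ℝ) :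
    cycleStrand r X i k t = 0 := by
  simp [cycleStrand, hi]

/-! ## §4 The intertwining identity -/

/-- **GENERAL REDUCTION (any `c₀, c₁`): each strand obeys a nearest-neighbour CHAIN equation with
2-PERIODIC coefficients.**  Along ANY family `X`, at shell `n` the 2-cycle nonlinearity of the mode
the strand `r` occupies is `c_in·(1+ε₀)^{5(n-1)/2}·Y_{n-1}² − c_out·(1+ε₀)^{5n/2}·Y_n·Y_{n+1}` in
the strand amplitudes `Y_m = (cycleStrand r X) 0 m`, with `(c_in, c_out) = (c₁, c₀)` on even
positions (component `0`) and `(c₀, c₁)` on odd positions (component `1`).  For `c₀ ≠ c₁` this is a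
2-periodic Katz–Pavlović chain (no table/barrier for it is in the tree yet); for `c₀ = c₁` it is the
scaled dyadic chain (`quadTerm_cycleStrand`).  Pure algebra + parity. [this file] -/
theorem quadTerm_kpTwoCycle_phase (ε₀ c₀ c₁ : ℝ) (r : ℤ) (X : Fin 4 → ℤ → ℝ → ℝ) (n : ℤ) (t : ℝ) :
    quadTerm ε₀ (kpTwoCycleTable c₀ c₁) X (cyclePhase r n) n t =
      (if (n + r) % 2 = 0 then c₁ else c₀) *
          ((1 + ε₀) ^ ((5 : ℝ) * (n - 1) / 2) * cycleStrand r X 0 (n - 1) t ^ 2) -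
        (if (n + r) % 2 = 0 then c₀ else c₁) *
          ((1 + ε₀) ^ ((5 : ℝ) * n / 2) * (cycleStrand r X 0 n t * cycleStrand r X 0 (n + 1) t)) := by
  rw [cycleStrand_zero, cycleStrand_zero, cycleStrand_zero]
  by_cases h : (n + r) % 2 = 0
  · obtain ⟨h0, hm, hp⟩ := cyclePhase_neighbours_of_even h
    rw [h0, hm, hp, quadTerm_kpTwoCycle_zero, if_pos h, if_pos h]
  · obtain ⟨h1, hm, hp⟩ := cyclePhase_neighbours_of_odd h
    rw [h1, hm, hp, quadTerm_kpTwoCycle_one, if_neg h, if_neg h]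

/-! ### Uniform coefficient: the strand IS the scaled dyadic chain -/

/-- **INTERTWINING.** Along ANY family `X`, the `c·dyadicTable` nonlinearity of the strand `r` at
shell `n` equals the uniform 2-cycle nonlinearity of the lattice mode the strand occupies there:
`quadTerm ε₀ (c·dyadicTable) (cycleStrand r X) 0 n t = quadTerm ε₀ (kpTwoCycleTable c c) X (cyclePhase r n) n t`.
Pure algebra + parity. [this file] -/
theorem quadTerm_cycleStrand (ε₀ c : ℝ) (r : ℤ) (X : Fin 4 → ℤ → ℝ → ℝ) (n : ℤ) (t : ℝ) :
    quadTerm ε₀ (fun i₁ i₂ i₃ μ => c * dyadicTable i₁ i₂ i₃ μ) (cycleStrand r X) 0 n t =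
      quadTerm ε₀ (kpTwoCycleTable c c) X (cyclePhase r n) n t := by
  rw [dyadicRatioTwo_quadTerm_const_mul (β := dyadicTable) (c := c) (fun _ _ _ _ => rfl),
    quadTerm_dyadicTable_zero, cycleStrand_zero, cycleStrand_zero, cycleStrand_zero]
  by_cases h : (n + r) % 2 = 0
  · obtain ⟨h0, hm, hp⟩ := cyclePhase_neighbours_of_even h
    rw [h0, hm, hp, quadTerm_kpTwoCycle_zero]
    ring
  · obtain ⟨h1, hm, hp⟩ := cyclePhase_neighbours_of_odd h
    rw [h1, hm, hp, quadTerm_kpTwoCycle_one]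
    ring

/-! ## §5 Strands of honest 2-cycle solutions are honest chain solutions -/

/-- **Honesty transfer to a strand.**  If `X` satisfies the solution clauses of the cruxes for the
uniform 2-cycle on `[0,s]` from the one-shell datum `X₀` and is non-negative on shells `≥ 1`, then
`cycleStrand r X` satisfies them for `c·dyadicTable` from the datum `X₀(cyclePhase r 0)·e₀`, and is
non-negative on shells `≥ 1`.  MODEL lattice bookkeeping. [this file] -/
theorem cycleStrand_honest {ε₀ ν c s : ℝ} (r : ℤ) {X₀ : Fin 4 → ℝ} {X : Fin 4 → ℤ → ℝ → ℝ}
    (hinit : ∀ (i : Fin 4) (k : ℤ), X i k 0 = if k = 0 then X₀ i else 0)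
    (hlow : ∀ (i : Fin 4) (k : ℤ), k < 0 → ∀ t : ℝ, X i k t = 0)
    (hbd : ∃ M : ℝ, ∀ (t : ℝ) (i : Fin 4) (k : ℤ), (1 + (1 + ε₀) ^ ((10 : ℝ) * k)) * |X i k t| ≤ M)
    (hcont : ∀ (i : Fin 4) (k : ℤ), Continuous (X i k))
    (hder : ∀ (i : Fin 4) (k : ℤ), ∀ t ∈ Icc (0 : ℝ) s, HasDerivWithinAt (X i k)
      (quadTerm ε₀ (kpTwoCycleTable c c) X i k t - ν * (1 + ε₀) ^ ((2 : ℝ) * k) * X i k t)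
      (Icc (0 : ℝ) s) t)
    (hnn : ∀ t ∈ Icc (0 : ℝ) s, ∀ (i : Fin 4) (k : ℤ), 1 ≤ k → 0 ≤ X i k t) :
    (∀ (i : Fin 4) (k : ℤ), cycleStrand r X i k 0 =
        if k = 0 then (fun i : Fin 4 => if i = 0 then X₀ (cyclePhase r 0) else 0) i else 0) ∧
    (∀ (i : Fin 4) (k : ℤ), k < 0 → ∀ t : ℝ, cycleStrand r X i k t = 0) ∧
    (∃ M : ℝ, ∀ (t : ℝ) (i : Fin 4) (k : ℤ),
      (1 + (1 + ε₀) ^ ((10 : ℝ) * k)) * |cycleStrand r X i k t| ≤ M) ∧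
    (∀ (i : Fin 4) (k : ℤ), Continuous (cycleStrand r X i k)) ∧
    (∀ (i : Fin 4) (k : ℤ), ∀ t ∈ Icc (0 : ℝ) s, HasDerivWithinAt (cycleStrand r X i k)
      (quadTerm ε₀ (fun i₁ i₂ i₃ μ => c * dyadicTable i₁ i₂ i₃ μ) (cycleStrand r X) i k t -
        ν * (1 + ε₀) ^ ((2 : ℝ) * k) * cycleStrand r X i k t) (Icc (0 : ℝ) s) t) ∧
    (∀ t ∈ Icc (0 : ℝ) s, ∀ (i : Fin 4) (k : ℤ), 1 ≤ k → 0 ≤ cycleStrand r X i k t) := by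
  obtain ⟨M, hM⟩ := hbd
  have hM0 : 0 ≤ M := by
    have h := hM 0 0 0
    have h1 : (0 : ℝ) ≤ (1 + (1 + ε₀) ^ ((10 : ℝ) * ((0 : ℤ) : ℝ))) * |X 0 0 0| := by
      have : (1 + ε₀) ^ ((10 : ℝ) * ((0 : ℤ) : ℝ)) = 1 := by simp
      rw [this]; positivity
    exact h1.trans h
  refine ⟨fun i k => ?_, fun i k hk t => ?_, ⟨M, fun t i k => ?_⟩, fun i k => ?_, fun i k t ht => ?_,
    fun t ht i k hk => ?_⟩
  · -- datum
    by_cases hi : i = 0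
    · subst hi
      rw [cycleStrand_zero, hinit]
      by_cases hk : k = 0
      · subst hk; simp
      · simp [hk]
    · rw [cycleStrand_of_ne r X hi]
      by_cases hk : k = 0 <;> simp [hk, hi]
  · -- no low shells
    by_cases hi : i = 0
    · subst hi; rw [cycleStrand_zero]; exact hlow _ k hk t
    · exact cycleStrand_of_ne r X hi k t
  · -- (4.5) bound
    by_cases hi : i = 0
    · subst hi; rw [cycleStrand_zero]; exact hM t _ k
    · rw [cycleStrand_of_ne r X hi, abs_zero, mul_zero]; exact hM0
  · -- continuity
    by_cases hi : i = 0
    · subst hi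
      have : cycleStrand r X 0 k = X (cyclePhase r k) k := funext fun t => cycleStrand_zero r X k t
      rw [this]; exact hcont _ k
    · have : cycleStrand r X i k = fun _ => 0 := funext fun t => cycleStrand_of_ne r X hi k t
      rw [this]; exact continuous_const
  · -- exact motion
    by_cases hi : i = 0
    · subst hi
      have hfun : cycleStrand r X 0 k = X (cyclePhase r k) k :=
        funext fun t => cycleStrand_zero r X k t
      rw [hfun, quadTerm_cycleStrand]
      exact hder _ k t ht
    · have hfun : cycleStrand r X i k = fun _ => 0 := funext fun t => cycleStrand_of_ne r X hi k t
      have hq : quadTerm ε₀ (fun i₁ i₂ i₃ μ => c * dyadicTable i₁ i₂ i₃ μ) (cycleStrand r X) i k t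
          = 0 := dyadicRatioTwo_quadTerm_of_ne (fun _ _ _ _ => rfl) _ hi k t
      rw [hfun, hq]
      simpa using hasDerivWithinAt_const t (Icc (0 : ℝ) s) (0 : ℝ)
  · -- non-negativity on shells ≥ 1
    by_cases hi : i = 0
    · subst hi; rw [cycleStrand_zero]; exact hnn t ht _ k hk
    · rw [cycleStrand_of_ne r X hi]

end Summit.NavierStokesRegularity.NavierStokesRegularity.Theorems

end
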